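import Summits.QuantumFields.YangMills.Theorems.BalabanUVNodesK0RecordFormatNamesCentredPair
import Summits.QuantumFields.YangMills.Theorems.BalabanUVNodesPortU8IotaRow
import Summits.QuantumFields.YangMills.Theorems.BalabanUVNodesPortU8Response9

/-!
# K0⁷ — RECORD-SIDE FORMAT NAMES, LEMMAS 14: the CENTRED PAIR of ed.19 AT `B = 0`, and the D13 response-link row BY `rfl`
# (`recordBgFieldC 0 = 1`, `recordCurrentC 0 = 0`, ★ `recordEmbJC 0 = 0`, ★ `recordGkJC = Dι^C(0)`; JOIN-T v2's D13 rows at `ιC := recordEmbJC`, all but the `ContDiffAt` conjunct)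

Cell `ym-nodeO-ideate` ∕ `ym-balaban-port`, DEFINER seat `ym-nodeO-def-1` (gen 36); `--kind proof --supports stmt-QuantumFields-20541 --as helper`; count-neutral; THEOREMS ONLY, faces
of ed.19's names (`…K0RecordFormatNamesCentredPair`, ✓p816161) — byte-twins of ★ PTB-1's ✓ `…PortU8IotaRow` faces for the rooted pair (`recordBgField_zero ∕ recordBgUnits_zero ∕
recordCurrent_zero ∕ recordEmbJ_zero ∕ recordEmbJ_zero_thetaFill`), through DEF-1 g35's ✓ `RootedGaugeCentred.rootGaugeC_one`.
[I] = [Balaban1987RG1].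

WHY.  ◇ lens-1 g9's JOIN-T v2 (`nodeO-cover/LENS-1g9-JoinT-v2.lean` b7b49705, ★★★ director-ym №533) displays, for the ONE centred chart `ιC`, the D13 identity rows
`∀ n, ContDiffAt ℝ 2 (ιC k n) 0 ∧ ιC k n 0 = 0` and `∀ n a l, recordGkJC F θ k (K₀+n) a l = fun i => fderiv ℝ (ιC k n) 0 (Pi.single l.1 (Pi.single l.2 (θ.bV a))) i`.  At the intended
instance `ιC k n := recordEmbJC F θ k (recordK₀ F Mc k + n)` (ed.19) the LINK row is `rfl` (it is `recordGkJC`'s definition) and the VALUE conjunct `ιC k n 0 = 0` is the centred twin of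
PTB-1's `recordEmbJ_zero`: `recordBgFieldC 0 = rootGaugeC (k+1) (recordBgField 0) = rootGaugeC (k+1) 1 = 1`, the current of `1` is `0`, `mlog 1 = 0`, `sl2Coord 0 = 0`.  Only the `ContDiffAt`
conjunct (P0's HypAn read at the centred pair) stays displayed.  №533 (3) HANDS LEVER: these are the D13 rows «RECORD FACT, dischargeable now, size S» — discharged here BY NAME.

WHAT THIS FILE IS (theorems only):
* §1 at `B = 0` (standing range `k + 1 ≤ m + K`, `0 < θ.εbg`): `recordBgFieldC_zero`, `recordBgUnitsC_zero`, `recordCurrentC_zero`, ★ `recordEmbJC_zero`; and the port-text instance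
  ★ `recordEmbJC_zero_thetaFill (ha₀ : 0 < a₀) (Mc k n)` at `θ := thetaFill F a₀ ε₂₉`, `K := recordK₀ F Mc k + n` (background radius `εbg = a₀`, `theta13OfThm1CCMWZB_εbg`).
* §2 the D13 LINK row: ★ `recordGkJC_eq_fderiv` (`rfl`) and its `thetaFill` instance `recordGkJC_link_thetaFill` in JOIN-T v2's binder shape.
* §3 D9's BOOKKEEPING ROWS (R0)(R3)(R5) at the centred receipts — THE FRAMES ★★ `response9DAtJC_of_decayRows` ∕ `response9DAtLC_of_decayRows`: `Response9DAtJC ∕ Response9DAtLC … (recordK₀ F Mc k) α₂ C₉ δ₀`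
  from `0 ≤ C₉`, `0 ≤ δ₀` and the two DECAY rows (R1ᴰ)(R4ᴰ) of the centred response ONLY (the Gk-free rows (R3)(R5) are ★ PTB-1's ✓ `rowR3_record ∕ rowR5_record`, byte-twin of his
  ✓ `response9D_fromJ_of_decayRows`) — ◆ CRIT-1 g36's hand-γ rows «D9's (R0)(R3)(R5) [S]» (nodeO STATUS 2026-08-31T08:30:26Z) discharged BY NAME; what remains of D9 is its decay CONTENT.

HONEST FRAMING.  Bookkeeping at the flat point + the Gk-free rows of the centred receipts; NO estimate of Bałaban's; nothing asserted, ported or discharged beyond these `B = 0` ∕ `rfl` ∕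
(R3)(R5) faces — the DECAY rows (R1ᴰ)(R4ᴰ) of `Response9DAtJC ∕ LC` are [15] Prop. 9 (190) content at the centred representative (W-(190), UNPORTED, displayed as hypotheses of the frames); the `ContDiffAt ℝ 2 (recordEmbJC …) 0`
conjunct is P0's HypAn (OPEN, `P0Content` ⟨stmt-QuantumFields-26900⟩ typed, not proved); D9 `Response9DAtJC`, the swap row, (G0)–(G4), D1 = [R-W] remain DISPLAYED; 27931
CLOSED·IMPLICATION-ONLY·IN TOTO; 27930 ∕ 26648 OPEN; K0ᴬ ∕ K1ᴬ ∕ K3ᴬ OPEN; NODE O not inhabited (0∕1); COUNT 8∕28 · K 1∕4 UNMOVED; finite `𝕋⁴_{L^K}` at fixed ε — NOT continuum ∕ ℝ⁴ ∕ OS;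
**the Yang–Mills mass gap (Clay) is NOT proved by any of this.**  No `sorry`; standard axioms.
-/

noncomputable section

open scoped BigOperators Matrix.Norms.L2Operator

namespace Summit.QuantumFields.YangMills.Theorems.K0RecordFormatNames

open Literature.MathematicalPhysics.QuantumFieldTheory.Balaban1983to89
open Literature.MathematicalPhysics.QuantumFieldTheory.Balaban1983to89.Node00
open Literature.MathematicalPhysics.QuantumFieldTheory.Balaban1983to89.T4Continuum (T4Family)
open Summit.QuantumFields.YangMills.Theorems.RootedGaugeCentred (rootGaugeC rootGaugeC_one)
open Summit.QuantumFields.YangMills.Theorems.PortU8 (recordBgField_zero current_one sl2Coord_zero)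

variable (F : T4Family) (θ : Stage13Params F 2)

/-! ## §1  The centred pair at `B = 0` -/

/-- **`recordBgFieldC 0 = 1`**: the CENTRED background of the configuration charted by `B = 0` is the unit configuration — `rootGaugeC (k+1) (recordBgField 0) = rootGaugeC (k+1) 1 = 1`
(★ PTB-1's `recordBgField_zero` + DEF-1 g35's `rootGaugeC_one`). [cite: Balaban1987RG1, (0.21) p.256, (2.3) p.265 (bookkeeping)] -/
theorem recordBgFieldC_zero (k K : ℕ) (hk : k + 1 ≤ (F.P K).m + (F.P K).K) (hε : 0 < θ.εbg) :
    (letI := θ.instVβ₁; letI := θ.instVβ₂; recordBgFieldC F θ k K 0) = 1 := by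
  letI := θ.instVβ₁; letI := θ.instVβ₂
  show rootGaugeC (k + 1) (recordBgField F θ k K 0) = 1
  rw [recordBgField_zero F θ k K hk hε]
  exact rootGaugeC_one _

/-- The units-valued CENTRED background at `B = 0` is the unit configuration. [cite: Balaban1987RG1, (1.8)–(1.9) p.261 (bookkeeping)] -/
theorem recordBgUnitsC_zero (k K : ℕ) (hk : k + 1 ≤ (F.P K).m + (F.P K).K) (hε : 0 < θ.εbg) :
    (letI := θ.instVβ₁; letI := θ.instVβ₂; recordBgUnitsC F θ k K 0) = 1 := by
  letI := θ.instVβ₁; letI := θ.instVβ₂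
  funext b
  show ιSU 2 (recordBgFieldC F θ k K 0 b) = 1
  rw [recordBgFieldC_zero F θ k K hk hε]
  show ιSU 2 1 = 1
  exact map_one _

/-- **`J_{k+1}(recordBgFieldC 0) = 0`**: the current of the CENTRED background at `B = 0` vanishes (the current of the unit configuration is `0`, ★ PTB-1's `current_one`).
[cite: Balaban1987RG1, (1.8) p.261 (bookkeeping)] -/
theorem recordCurrentC_zero (k K : ℕ) (hk : k + 1 ≤ (F.P K).m + (F.P K).K) (hε : 0 < θ.εbg) :
    (letI := θ.instVβ₁; letI := θ.instVβ₂; recordCurrentC F θ k K 0) = 0 := by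
  letI := θ.instVβ₁; letI := θ.instVβ₂
  show B12Eq18Current.current sl2Proj ((F.P K).eta (k + 1)) (recordBgUnitsC F θ k K 0) = 0
  rw [recordBgUnitsC_zero F θ k K hk hε]
  exact current_one _ _

/-- ★ **`ι^C(0) = 0` (two-block, centred)**: `recordEmbJC F θ k K 0 = 0` — both blocks of the centred pair's coordinates vanish at `B = 0` (`log 1 = 0`, `J(1) = 0`); the VALUE conjunct
of JOIN-T v2's D13 row at `ιC := recordEmbJC`.  Centred twin of ★ PTB-1's `recordEmbJ_zero`. [cite: Balaban1987RG1, (4.35) p.290, (1.9) p.261 (bookkeeping)] -/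
theorem recordEmbJC_zero (k K : ℕ) (hk : k + 1 ≤ (F.P K).m + (F.P K).K) (hε : 0 < θ.εbg) :
    (letI := θ.instVβ₁; letI := θ.instVβ₂; recordEmbJC F θ k K 0) = 0 := by
  letI := θ.instVβ₁; letI := θ.instVβ₂
  have hbg := recordBgFieldC_zero F θ k K hk hε
  have hcur := recordCurrentC_zero F θ k K hk hε
  funext i
  show Sum.elim (fun a => sl2Coord (MatrixLog.mlog ((recordBgFieldC F θ k K 0 ((chartEquivJ F K).symm i).1 : SU 2) : MatA 2)) a)
      (fun a => sl2Coord (recordCurrentC F θ k K 0 ((chartEquivJ F K).symm i).1) a) ((chartEquivJ F K).symm i).2 = 0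
  rw [hbg, hcur]
  show Sum.elim (fun a => sl2Coord (MatrixLog.mlog ((1 : SU 2) : MatA 2)) a) (fun a => sl2Coord (0 : MatA 2) a) ((chartEquivJ F K).symm i).2 = 0
  have h1 : ((1 : SU 2) : MatA 2) = 1 := rfl
  rw [h1, MatrixLog.mlog_one, sl2Coord_zero]
  cases ((chartEquivJ F K).symm i).2 <;> rfl

/-- ★ **THE JOIN-T INSTANCE of the value conjunct**: at `θ := thetaFill F a₀ ε₂₉` (background radius `εbg = a₀`, `theta13OfThm1CCMWZB_εbg`) and the volumes `K := recordK₀ F Mc k + n`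
(so `k + 1 ≤ K ≤ m + K`): for `0 < a₀`, every `k`, `n`, `recordEmbJC F (thetaFill F a₀ ε₂₉) k (recordK₀ F Mc k + n) 0 = 0` — JOIN-T v2's `ιC k n 0 = 0` at `ιC := recordEmbJC`.
[cite: Balaban1987RG1, (4.35) p.290, (1.9) p.261, (1.21) p.264 (bookkeeping)] -/
theorem recordEmbJC_zero_thetaFill (a₀ ε₂₉ : ℝ) (ha₀ : 0 < a₀) (Mc k n : ℕ) :
    letI θ := thetaFill F a₀ ε₂₉; letI := θ.instVβ₁; letI := θ.instVβ₂;
    recordEmbJC F θ k (recordK₀ F Mc k + n) 0 = 0 := by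
  refine recordEmbJC_zero F (thetaFill F a₀ ε₂₉) k (recordK₀ F Mc k + n) ?_ ?_
  · simp only [T4Family.P_m, T4Family.P_K, recordK₀]
    omega
  · show 0 < a₀
    exact ha₀

/-! ## §2  The D13 response-link row: `recordGkJC` IS `Dι^C(0)` on the basis fields (`rfl`) -/

/-- ★ **LINK (by `rfl`)**: `recordGkJC F θ k K a l = fun i => fderiv ℝ (recordEmbJC F θ k K) 0 (Pi.single l.1 (Pi.single l.2 (θ.bV a))) i` — ed.19's `recordGkJC` IS the first derivative of the
centred chart at `0` on the basis field `δ_l ⊗ bV a`, by definition; JOIN-T v2's D13 link row at `ιC := recordEmbJC`. [cite: Balaban1987RG1, (4.35) p.290; Balaban1985Variational, Prop. 9 p.309 (bookkeeping)] -/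
theorem recordGkJC_eq_fderiv (k K : ℕ) (a : θ.ιβ) (l : RespLabel F k K) :
    letI := θ.instVβ₁; letI := θ.instVβ₂; letI := θ.instιβ
    recordGkJC F θ k K a l = fun i => fderiv ℝ (recordEmbJC F θ k K) 0 (Pi.single l.1 (Pi.single l.2 (θ.bV a))) i := rfl

/-- **THE JOIN-T INSTANCE of the link row** (binder shape of `nodeO-cover/LENS-1g9-JoinT-v2.lean`'s hypothesis, at `ιC k n := recordEmbJC F θ k (recordK₀ F Mc k + n)`): for every `k n a l`,
`recordGkJC F θ k (recordK₀ F Mc k + n) a l = fun i => fderiv ℝ (recordEmbJC F θ k (recordK₀ F Mc k + n)) 0 (Pi.single l.1 (Pi.single l.2 (θ.bV a))) i` — `rfl`.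
[cite: Balaban1987RG1, (4.35) p.290, (1.21) p.264 (bookkeeping)] -/
theorem recordGkJC_link_thetaFill (a₀ ε₂₉ : ℝ) (Mc k n : ℕ) :
    letI θ := thetaFill F a₀ ε₂₉; letI := θ.instVβ₁; letI := θ.instVβ₂; letI := θ.instιβ
    ∀ (a : θ.ιβ) (l : RespLabel F k (recordK₀ F Mc k + n)),
      recordGkJC F θ k (recordK₀ F Mc k + n) a l = fun i => fderiv ℝ (recordEmbJC F θ k (recordK₀ F Mc k + n)) 0 (Pi.single l.1 (Pi.single l.2 (θ.bV a))) i :=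
  fun _ _ => rfl

/-! ## §3  D9's bookkeeping rows at the centred receipts: `Response9DAtJC ∕ Response9DAtLC` from their two decay rows only -/

open Summit.QuantumFields.YangMills.Theorems.PortU8 (rowR3_record rowR5_record) in
variable {F} in
/-- ★★ **THE FRAME AT THE CENTRED-PAIR RECEIPT** — `Response9DAtJC F θ a Mc k (recordK₀ F Mc k) α₂ C₉ δ₀` HOLDS as soon as `0 ≤ C₉`, `0 ≤ δ₀` and the two DECAY rows of the centred
pair's cut response hold: (R1ᴰ) the gauge decay of `cutTo (recordCXJ …) (recordGkJC … a y)` in the (4.4) domain norm, and (R4ᴰ) the two-volume comparison of `recordGkJC` across `K₀+n → K₀+n+1`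
on the centred window of radius `recordRNat` — both [15] Prop. 9 (190)-type CONTENT at the CENTRED representative (J5′ EXEMPT), displayed as hypotheses; the bookkeeping rows (R3) ∕ (R5) are
★ PTB-1's ✓ `rowR3_record ∕ rowR5_record` (the non-`Gk` fields of `recordResponse9DataFromJC` ARE `…FromJ`'s).  Byte-twin of ✓ `PortU8.response9D_fromJ_of_decayRows`.  Nothing of [15] asserted.
[cite: Balaban1985Variational, Prop. 9 p.309, (190) p.308; Balaban1987RG1, (1.7) p.261, (1.21) p.264, (4.4) p.281, (4.35) p.290] -/
theorem response9DAtJC_of_decayRows {Mc : ℕ} (hMc : McGuard F Mc) (θ : Stage13Params F 2) (a : θ.ιβ) (k : ℕ) {α₂ C₉ δ₀ : ℝ}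
    (hC : 0 ≤ C₉) (hδ : 0 ≤ δ₀)
    (hR1 : ∀ (n : ℕ) (X : (recordDomSys F Mc k (recordK₀ F Mc k + n)).Dom) (y : RespLabel F k (recordK₀ F Mc k + n)),
      gauge (recordDom44J F Mc k (recordK₀ F Mc k + n) X α₂)
        (B12FormatPlus.cutTo (recordCXJ F Mc k (recordK₀ F Mc k + n) X) (recordGkJC F θ k (recordK₀ F Mc k + n) a y)) ≤
        C₉ * Real.exp (-δ₀ * (recordSiteGeom F Mc k (recordK₀ F Mc k + n)).distD y X))
    (hR4 : ∀ (n : ℕ) (X : (recordDomSys F Mc k (recordK₀ F Mc k + n)).Dom), X ∉ recordWrapCtr F Mc k (recordK₀ F Mc k + n) →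
      ∀ (μ : Fin 4) (z : Fin 4 → ℤ), (∀ l, 2 * |z l| < (recordRNat F Mc k (recordK₀ F Mc k + n) : ℤ)) →
      gauge (recordDom44J F Mc k (recordK₀ F Mc k + n) X α₂)
        (B12FormatPlus.cutTo (recordCXJ F Mc k (recordK₀ F Mc k + n) X) fun i =>
          recordGkJC F θ k (recordK₀ F Mc k + (n + 1)) a (recordE F k (recordK₀ F Mc k + (n + 1)) μ z) (recordJXJ F (recordK₀ F Mc k + n) i) -
            recordGkJC F θ k (recordK₀ F Mc k + n) a (recordE F k (recordK₀ F Mc k + n) μ z) i) ≤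
        C₉ * Real.exp (-δ₀ * (recordRNat F Mc k (recordK₀ F Mc k + n) : ℝ) / 2) *
          Real.exp (-(δ₀ / 2) * (recordSiteGeom F Mc k (recordK₀ F Mc k + n)).distD (recordE F k (recordK₀ F Mc k + n) μ z) X)) :
    Response9DAtJC F θ a Mc k (recordK₀ F Mc k) α₂ C₉ δ₀ :=
  ⟨hC, hδ, hR1, fun _ X hX _ hi => rowR3_record hMc (Nat.le_add_right _ _) X hX hi, hR4,
    fun _ X hX w' => rowR5_record hMc (Nat.le_add_right _ _) X hX w'⟩

open Summit.QuantumFields.YangMills.Theorems.PortU8 (rowR3_record rowR5_record) in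
variable {F} in
/-- ★★ **THE FRAME AT THE CENTRED-LANDAU RECEIPT** — `Response9DAtLC F θ a Mc k (recordK₀ F Mc k) α₂ C₉ δ₀` from `0 ≤ C₉`, `0 ≤ δ₀` and the two DECAY rows (R1ᴰ)(R4ᴰ) of `recordGkLC`
(𝐔-block `recordHrC`, 𝐉-block rooted); (R3) ∕ (R5) by ★ PTB-1's ✓ `rowR3_record ∕ rowR5_record`.  Displayed decay rows = (190)-type CONTENT at the centred-Landau representative, not asserted.
[cite: Balaban1985Variational, Prop. 9 p.309, (190) p.308, (21) p.281; Balaban1987RG1, (1.7) p.261, (1.21) p.264, (4.4) p.281, (4.35) p.290] -/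
theorem response9DAtLC_of_decayRows {Mc : ℕ} (hMc : McGuard F Mc) (θ : Stage13Params F 2) (a : θ.ιβ) (k : ℕ) {α₂ C₉ δ₀ : ℝ}
    (hC : 0 ≤ C₉) (hδ : 0 ≤ δ₀)
    (hR1 : ∀ (n : ℕ) (X : (recordDomSys F Mc k (recordK₀ F Mc k + n)).Dom) (y : RespLabel F k (recordK₀ F Mc k + n)),
      gauge (recordDom44J F Mc k (recordK₀ F Mc k + n) X α₂)
        (B12FormatPlus.cutTo (recordCXJ F Mc k (recordK₀ F Mc k + n) X) (recordGkLC F θ k (recordK₀ F Mc k + n) a y)) ≤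
        C₉ * Real.exp (-δ₀ * (recordSiteGeom F Mc k (recordK₀ F Mc k + n)).distD y X))
    (hR4 : ∀ (n : ℕ) (X : (recordDomSys F Mc k (recordK₀ F Mc k + n)).Dom), X ∉ recordWrapCtr F Mc k (recordK₀ F Mc k + n) →
      ∀ (μ : Fin 4) (z : Fin 4 → ℤ), (∀ l, 2 * |z l| < (recordRNat F Mc k (recordK₀ F Mc k + n) : ℤ)) →
      gauge (recordDom44J F Mc k (recordK₀ F Mc k + n) X α₂)
        (B12FormatPlus.cutTo (recordCXJ F Mc k (recordK₀ F Mc k + n) X) fun i =>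
          recordGkLC F θ k (recordK₀ F Mc k + (n + 1)) a (recordE F k (recordK₀ F Mc k + (n + 1)) μ z) (recordJXJ F (recordK₀ F Mc k + n) i) -
            recordGkLC F θ k (recordK₀ F Mc k + n) a (recordE F k (recordK₀ F Mc k + n) μ z) i) ≤
        C₉ * Real.exp (-δ₀ * (recordRNat F Mc k (recordK₀ F Mc k + n) : ℝ) / 2) *
          Real.exp (-(δ₀ / 2) * (recordSiteGeom F Mc k (recordK₀ F Mc k + n)).distD (recordE F k (recordK₀ F Mc k + n) μ z) X)) :
    Response9DAtLC F θ a Mc k (recordK₀ F Mc k) α₂ C₉ δ₀ :=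
  ⟨hC, hδ, hR1, fun _ X hX _ hi => rowR3_record hMc (Nat.le_add_right _ _) X hX hi, hR4,
    fun _ X hX w' => rowR5_record hMc (Nat.le_add_right _ _) X hX w'⟩

end Summit.QuantumFields.YangMills.Theorems.K0RecordFormatNames

end
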